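import Mathlib
import Summits.Ventures.PercRepro2.Defs
import Summits.Ventures.PercRepro2.Graph
import Summits.Ventures.PercRepro2.Events

/-!
# The cycle graph and the arc structure of its root cluster (blind cell PercRepro2, mine-a g47)

The cycle `C_{n+1}` on the vertices `Fin (n+1)`: edge `i` joins `i` and `i + 1` (addition in
`Fin (n+1)`, so the last edge `Fin.last n` joins `Fin.last n` and the root `0`).  The cluster of the
root in a configuration `ω` is an *arc*: a vertex `v` lies in it exactly when the clockwise path
`0, 1, …, v` is open (every edge `i < v` open) or the counter-clockwise path `0, n, n−1, …, v` is
open (every edge `i ≥ v` open).  In terms of the set `Z` of closed edges: `v` is below every closed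
edge or above every closed edge (`cluster_eq_arc`).  So the root cluster is `V ∖ (min Z, max Z]`
(the vertices strictly inside the hull of the closed edges are cut off), it is the whole vertex
set when at most one edge is closed, and every cluster event of the cycle is a function of the hull
of the closed set (MINE-A.md §102.0).  No instance, no notation.
-/

namespace Summit.Ventures.PercRepro2

namespace TCycle

open Finset

/-- The cycle on `Fin (n+1)`: edge `i` joins the vertices `i` and `i + 1`. -/
def ends (n : ℕ) : Fin (n + 1) → Sym2 (Fin (n + 1)) := fun i => s(i, i + 1)

/-- The closed edges of a configuration, as a finset. -/
def closedSet {n : ℕ} (ω : Config (Fin (n + 1))) : Finset (Fin (n + 1)) :=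
  univ.filter fun i => ω i = false

/-- The *arc* of a set `Z` of closed edges: the vertices below every element of `Z` or above every
element of `Z`; the root cluster of the cycle when exactly the edges of `Z` are closed. -/
def arc {n : ℕ} (Z : Finset (Fin (n + 1))) : Set (Fin (n + 1)) :=
  {v | (∀ i ∈ Z, v ≤ i) ∨ (∀ i ∈ Z, i < v)}

/-- Membership in `closedSet`. -/
@[simp] lemma mem_closedSet {n : ℕ} {ω : Config (Fin (n + 1))} {i : Fin (n + 1)} :
    i ∈ closedSet ω ↔ ω i = false := by
  simp [closedSet]

/-- Membership in `arc`. -/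
lemma mem_arc {n : ℕ} {Z : Finset (Fin (n + 1))} {v : Fin (n + 1)} :
    v ∈ arc Z ↔ (∀ i ∈ Z, v ≤ i) ∨ (∀ i ∈ Z, i < v) := Iff.rfl

/-- The root lies in every arc. -/
lemma zero_mem_arc {n : ℕ} (Z : Finset (Fin (n + 1))) : (0 : Fin (n + 1)) ∈ arc Z :=
  Or.inl fun i _ => Fin.zero_le i

/-- The arc is antitone in the closed set. -/
lemma arc_anti {n : ℕ} {Z Z' : Finset (Fin (n + 1))} (h : Z ⊆ Z') : arc Z' ⊆ arc Z := by
  intro v hv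
  rcases hv with hv | hv
  · exact Or.inl fun i hi => hv i (h hi)
  · exact Or.inr fun i hi => hv i (h hi)

/-- The arc of a set with at most one element is everything. -/
lemma arc_of_card_le_one {n : ℕ} {Z : Finset (Fin (n + 1))} (hZ : Z.card ≤ 1) :
    arc Z = Set.univ := by
  ext v
  simp only [Set.mem_univ, iff_true]
  rcases Finset.card_le_one.1 hZ with h
  by_cases hZe : Z = ∅
  · subst hZe; exact Or.inl fun i hi => absurd hi (Finset.notMem_empty i)
  · obtain ⟨i, hi⟩ := Finset.nonempty_iff_ne_empty.2 hZe
    by_cases hvi : v ≤ i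
    · exact Or.inl fun j hj => (h j hj i hi).symm ▸ hvi
    · exact Or.inr fun j hj => (h j hj i hi).symm ▸ lt_of_not_ge hvi

/-- The arc of the empty closed set is everything. -/
@[simp] lemma arc_empty {n : ℕ} : arc (∅ : Finset (Fin (n + 1))) = Set.univ :=
  arc_of_card_le_one (by simp)

section Paths

variable {n : ℕ} (ω : Config (Fin (n + 1)))

/-- Edge `i` of the cycle is an open adjacency between `i` and `i + 1` when open. -/
lemma openAdj_of_open {i : Fin (n + 1)} (hi : ω i = true) :
    OpenAdj (ends n) ω i (i + 1) := ⟨i, hi, rfl⟩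

/-- **The clockwise path**: if every edge below `v` is open, the root is connected to `v`. -/
lemma conn_zero_of_below (v : Fin (n + 1)) (h : ∀ i, i < v → ω i = true) :
    Conn (ends n) ω 0 v := by
  induction v using Fin.induction with
  | zero => exact conn_refl _ _ _
  | succ i ih =>
    have hlt : i.castSucc < i.succ := Fin.castSucc_lt_succ
    have hc : Conn (ends n) ω 0 i.castSucc :=
      ih fun j hj => h j (lt_trans hj hlt)
    have hadj : OpenAdj (ends n) ω i.castSucc (i.castSucc + 1) :=
      openAdj_of_open ω (h i.castSucc hlt)
    rw [Fin.coeSucc_eq_succ] at hadj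
    exact conn_trans hc (conn_of_openAdj hadj)

/-- **The counter-clockwise path**: if every edge from `v` on is open, the root is connected to
`v` (through the last edge, which joins `Fin.last n` and `0`). -/
lemma conn_zero_of_above (v : Fin (n + 1)) (h : ∀ i, v ≤ i → ω i = true) :
    Conn (ends n) ω 0 v := by
  induction v using Fin.reverseInduction with
  | last =>
    have hadj : OpenAdj (ends n) ω (Fin.last n) (Fin.last n + 1) :=
      openAdj_of_open ω (h _ le_rfl)
    rw [Fin.last_add_one] at hadj
    exact conn_symm (conn_of_openAdj hadj)
  | cast i ih =>
    have hlt : i.castSucc < i.succ := Fin.castSucc_lt_succ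
    have hc : Conn (ends n) ω 0 i.succ :=
      ih fun j hj => h j (le_trans hlt.le hj)
    have hadj : OpenAdj (ends n) ω i.castSucc (i.castSucc + 1) :=
      openAdj_of_open ω (h i.castSucc le_rfl)
    rw [Fin.coeSucc_eq_succ] at hadj
    exact conn_trans hc (conn_symm (conn_of_openAdj hadj))

/-- Every vertex of the arc of the closed set is connected to the root. -/
lemma conn_zero_of_mem_arc {v : Fin (n + 1)} (hv : v ∈ arc (closedSet ω)) :
    Conn (ends n) ω 0 v := by
  rcases hv with hv | hv
  · refine conn_zero_of_below ω v fun i hi => ?_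
    by_contra hcon
    have hi' : i ∈ closedSet ω := mem_closedSet.2 (by simpa using hcon)
    exact absurd hi (not_lt.2 (hv i hi'))
  · refine conn_zero_of_above ω v fun i hi => ?_
    by_contra hcon
    have hi' : i ∈ closedSet ω := mem_closedSet.2 (by simpa using hcon)
    exact absurd hi (not_le.2 (hv i hi'))

end Paths

section Closure

variable {n : ℕ}

/-- The successor of a non-last element of `Fin (n+1)` has the successor value. -/
lemma val_add_one_of_ne_last {i : Fin (n + 1)} (hi : i ≠ Fin.last n) :
    ((i + 1 : Fin (n + 1)) : ℕ) = (i : ℕ) + 1 := by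
  rw [Fin.val_add_one]
  simp [hi]

/-- **The arc is closed under open adjacency**: an open edge cannot leave the arc of the closed
set (the only edges leaving `V ∖ (min Z, max Z]` are the closed edges `min Z` and `max Z`). -/
lemma arc_closed_of_openAdj {ω : Config (Fin (n + 1))} {u w : Fin (n + 1)}
    (hu : u ∈ arc (closedSet ω)) (huw : OpenAdj (ends n) ω u w) : w ∈ arc (closedSet ω) := by
  obtain ⟨i, hi, hends⟩ := huw
  have hiZ : i ∉ closedSet ω := by simp [hi]
  simp only [ends, Sym2.eq_iff] at hends
  rcases hends with ⟨hu1, hw1⟩ | ⟨hw1, hu1⟩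
  · -- `u = i`, `w = i + 1`
    rw [← hw1]
    rw [← hu1] at hu
    by_cases hlast : i = Fin.last n
    · rw [hlast, Fin.last_add_one]
      exact zero_mem_arc _
    · have hval := val_add_one_of_ne_last hlast
      rcases hu with hu | hu
      · refine Or.inl fun j hj => ?_
        have hlt : i < j := lt_of_le_of_ne (hu j hj) (fun h => hiZ (h ▸ hj))
        rw [Fin.le_def, hval]
        exact hlt
      · refine Or.inr fun j hj => ?_
        have := hu j hj
        rw [Fin.lt_def, hval]
        exact Nat.lt_succ_of_lt this
  · -- `u = i + 1`, `w = i`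
    rw [← hw1]
    rw [← hu1] at hu
    by_cases hlast : i = Fin.last n
    · -- `u = 0`: the last edge is open, so every closed edge is below `Fin.last n`
      rw [hlast]
      refine Or.inr fun j hj => lt_of_le_of_ne (Fin.le_last j) fun h => hiZ (by rw [hlast]; exact h ▸ hj)
    · have hval := val_add_one_of_ne_last hlast
      rcases hu with hu | hu
      · refine Or.inl fun j hj => ?_
        have := hu j hj
        rw [Fin.le_def, hval] at this
        exact Fin.le_def.2 (Nat.le_of_succ_le this)
      · refine Or.inr fun j hj => ?_
        have := hu j hj
        rw [Fin.lt_def, hval] at this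
        have hle : j ≤ i := Fin.le_def.2 (Nat.lt_succ_iff.1 this)
        exact lt_of_le_of_ne hle fun h => hiZ (h ▸ hj)

/-- **The root cluster of the cycle is the arc of the closed edges**: a vertex lies in the cluster
of `0` exactly when every edge below it is open or every edge from it on is open. -/
theorem cluster_eq_arc (ω : Config (Fin (n + 1))) :
    cluster (ends n) ω 0 = arc (closedSet ω) := by
  ext v
  constructor
  · intro hv
    refine mem_of_conn_of_closed (ends := ends n) (ω := ω) (S := arc (closedSet ω)) ?_
      (zero_mem_arc _) hv
    intro x hx y hxy
    rw [openGraph_adj] at hxy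
    exact arc_closed_of_openAdj hx hxy.2
  · exact conn_zero_of_mem_arc ω

/-- The hit event of the cycle: `h ∈ C_0` iff every edge below `h` is open or every edge from `h`
on is open (the two routes from the root to `h`). -/
theorem mem_cluster_iff (ω : Config (Fin (n + 1))) (h : Fin (n + 1)) :
    h ∈ cluster (ends n) ω 0 ↔ (∀ i, i < h → ω i = true) ∨ (∀ i, h ≤ i → ω i = true) := by
  rw [cluster_eq_arc, mem_arc]
  constructor
  · rintro (hh | hh)
    · refine Or.inl fun i hi => ?_
      by_contra hcon
      exact absurd hi (not_lt.2 (hh i (mem_closedSet.2 (by simpa using hcon))))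
    · refine Or.inr fun i hi => ?_
      by_contra hcon
      exact absurd hi (not_le.2 (hh i (mem_closedSet.2 (by simpa using hcon))))
  · rintro (hh | hh)
    · refine Or.inl fun i hi => ?_
      by_contra hcon
      have := hh i (lt_of_not_ge hcon)
      rw [mem_closedSet] at hi
      simp [this] at hi
    · refine Or.inr fun i hi => ?_
      by_contra hcon
      have := hh i (le_of_not_gt hcon)
      rw [mem_closedSet] at hi
      simp [this] at hi

end Closure

end TCycle

end Summit.Ventures.PercRepro2
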